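import Literature.MathematicalPhysics.QuantumFieldTheory.Balaban1983to89.B8CubeMemberBoxRows
import Literature.MathematicalPhysics.QuantumFieldTheory.Balaban1983to89.B8Eq191FlatTowerGram
import Literature.MathematicalPhysics.QuantumFieldTheory.Balaban1983to89.B8LambdaSpaceKLevel
import Literature.MathematicalPhysics.QuantumFieldTheory.Balaban1983to89.B8Eq140Level

/-!
# `Balaban1983to89.B8Eq192CubeMemberOfReal1G` — [Balaban1985RegularSpaces] (1.92) + the p. 93 Δ-entry FROM (1.101) (exponents −2 and −4) AND THE 𝒢-BOUND on the
# cube member: the REAL-2 family of `B8Prop6CubeMemberFlatScalar.prop6_cubeMember_flat_of_real` REDUCED to one operator estimate on `𝒢 = (QT⁻²Qᵀ)⁻¹`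
# (p. 91 «H′ = G′²Q′*(Q′G′²Q′*)⁻¹ … (1.92)», p. 92 «from Theorems 3.1, 3.2 of [4] it follows …»)

statement-level skeleton of published theorems with citation tags; proofs where landed; nothing here is a claim about the
Yang–Mills mass gap

`[Balaban1985RegularSpaces]` ("B8", CMP **99** (1985) 75–102) (1.91)–(1.92) p. 91, p. 93 (the Δ-entry), (1.101) p. 93; `[Balaban1985BackgroundPropagators]` ("[4]", CMP **99**
(1985) 389–434) Theorem 3.1 with the global inequalities (3.47) p. 398 («for γ in a fixed compact subset of real numbers, e.g. for γ ∈ [−4, 4]»), Theorem 3.2 (3.48) p. 398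
(the kernel bound for `(Q′G′²Q′*)⁻¹`), (3.25) p. 394.  PDF held: `paper:balaban1985-cmp99-background-propagators` (pp. 397–398 read for this file).

CITATION HEADER (lean-in-tree rule).  Cell `pub-ymgap` (YM Track A, HUMAN RULING D-0062), DAG node N05 = [B8], seat `pub-ymgap-dag-n05-c` (g9; (R1′) programme, file F6).
State of the p6 flat road's three real families on the explicit matrices `T`, `Q` of the consumer: REAL-1 ((1.101), exponent −2 → 0) LANDED on print's big-block
sub-lattice (`B8Eq1101CubeMember{Real,RealGrad,Weights}`); REAL-3 ((1.98)) ⟸ REAL-1 + REAL-2 (`B8Eq198CubeMemberOfReal12`, F5); REAL-2 ((1.92) + Δ-entry for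
`H′ = T⁻¹(T⁻¹Qᵀ)(QT⁻²Qᵀ)⁻¹`) OPEN.  THIS FILE reduces REAL-2, exactly along print's sentence on p. 92, to: (a) REAL-1 (landed); (b) REAL-1′ = (1.101) at print's exponent
`γ = −4` ([4] (3.47) `|G′λ|₍₋₂₎ ≦ B₀|λ|₍₋₄₎`, function member — NOT yet landed; the same two-region parametrix as F4b∕F4c run on r05's general-exponent
`B8Ineq198MultiLevelBox.ineq1101_multiLevelBox`); (c) the 𝒢-BOUND = [4] Theorem 3.2 (3.48) row-summed, for `𝒢 = (QT⁻²Qᵀ)⁻¹` in the consumer's normalisation — the ONE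
genuinely open estimate of the road (the [B6] Prop. 2.3 analogue for the glued operator; design note `HOME/pub-ymgap-dag-n05-c/R23-DESIGN.md`).

WHAT THIS FILE PROVES (kernel-checked; theorems only; ANY `L ≥ 1`, dimension `d + 1`, cube datum with `L ≤ ρ`, truncation `n ≤ k`, ANY nonnegative weights `w` with
normalised size `w_jη²L^{2j}L^{−(d+1)j} ≤ a_max`).
* §1 `le_towerLevel` (a site of `□_j` has tower level `≥ j`), `wt_pow_even_mono` (even powers of `wt(j) = Lʲη` are monotone in `j`).
* §2 ★★★ `real2_of_real1_gbound` — in the consumer's VERBATIM shapes (`S`, `B`, `K`, `T = Matrix.of K`, `Q = Matrix.of …`, `wt`, `cubeFam`, `SideTouches`): REAL-1 (`B_G`) +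
  REAL-1′ (`B_G′`: `wt(j)⁴|u| ≤ r on □_j ⟹ wt(j)²|(T⁻¹u)(v)| ≤ B_G′ r on □_j`) + the 𝒢-bound (`C_𝒢`: `sup|X| ≤ s ⟹ wt(j_p)⁴ L^{−(d+1)j_p}|(𝒢X)_p| ≤ C_𝒢 s`) imply the
  consumer's REAL-2 block for `φ = H′X` (zero-extended): `|φ| ≤ B₀′_H s`, `wt(j)|η⁻¹∂φ| ≤ B₀′_H s` on the plaquettes touching `□_j`, `wt(j)²|η⁻²(−Δφ)| ≤ B₂′ s` on `□_j`,
  with `B₀′_H = B_G·(B_G′·C_𝒢)` and `B₂′ = B_G′·C_𝒢 + a_max`.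

HONEST SCOPE ∕ NOT CLAIMED.  Pure algebra + bookkeeping over three hypotheses; (b) and (c) are HYPOTHESES here ((b) mechanical but unlanded, (c) open).  The 𝒢-bound is
stated as the row-summed consequence of (3.48) in the consumer's normalisation (`Q(p,z) = L^{−(d+1)j_p}` on the tower `p`), which is what (1.92) consumes; it is NOT
print's kernel form with `e^{−δd(y,y′)}`.  Count-neutral; N05 NOT discharged; one finite `T⁴` programme at fixed `ε`, Bałaban as printed; nothing continuum ∕ ℝ⁴ ∕ OS ∕
mass-gap ∕ Clay.  No `sorry`, no `def`, no `instance`, no `notation`.  Unit `pub-ymgap-dag-n05-c` (g9), 2026-08-27.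

RELATED IN THE TREE, NOT DUPLICATED: `B8Prop6CubeMemberFlatScalar.prop6_cubeMember_flat_of_real` (the consumer; its REAL-2 block is reproduced verbatim as the conclusion),
`B8Eq198CubeMemberOfReal12.real3_of_real1_real2` (F5, the sibling reduction of REAL-3; not imported), `B8CubeMemberBoxRows.K_row_sum` (F2, USED on `S` enlarged by the
neighbours of the site), `B8Eq191FlatTowerGram.isUnit_towerGram`, `B8Eq191FlatDirichletForm.isUnit_flatMatrix`,
`B8Eq191FlatLettersCubeMember.towers_disjoint_cube`, `B8Eq191FlatDirichletConjugation.cover_cubeMember` (n05-e, USED), `B8Eq1101CubeMemberRealGrad.ineq1101_cubeMember_real`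
(REAL-1, feeds `hR1`), `B8Ineq198MultiLevelBox.ineq1101_multiLevelBox` (r05, general exponent on the Neumann box — the region-A input of the future REAL-1′),
`B6Prop23MultiLevelBox.prop23_multiLevelBox` (p21, [B6] Prop. 2.3 on the Neumann box — the deep local inverse of the future 𝒢-bound).
-/
noncomputable section

namespace Literature.MathematicalPhysics.QuantumFieldTheory.Balaban1983to89.B8Eq192CubeMemberOfReal1G

open scoped Matrix
open B7Prop1Explicit (e)
open B8Eq131Cubes (cube)
open B8Eq131CubesAdmissible (cubeFam cubeFam_false_of_le)
open B8Eq140Level (SideTouches)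
open B8CubeMemberZd (cubeLamS)
open B8LambdaSpaceKLevel (wt)
open B8Eq191FlatDirichletForm (isUnit_flatMatrix)
open B8Eq191FlatTowerGram (isUnit_towerGram)
open B8Eq191FlatLettersCubeMember (tower_meets_cube towers_disjoint_cube cubeFam_subset_zero)
open B8Eq191FlatDirichletCoercive (towerBlock_subset_cube)
open B8Eq191FlatDirichletConjugation (cover_cubeMember)
open B8Eq191FlatDirichletDepth (not_mem_cube_of_tower_lt)
open B8CubeMemberBoxRows (K_row_sum)
open Literature.MathematicalPhysics.QuantumLattice (blockMap)

variable {d : ℕ}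

/-! ## §1 Tower levels on the cube member -/

/-- On the cube member, a site of `□_j` (`j ≤ n`) whose level-`J` block is a tower of the truncation-`n` tower set has `j ≤ J`.
[cite: Balaban1985RegularSpaces, (1.31) p.81, (1.131) p.99] -/
theorem le_towerLevel {L : ℕ} (hL : 1 ≤ L) (a : Fin (d + 1) → ℤ) (M : ℕ) {ρ : ℕ} (hρ : L ≤ ρ) {k n : ℕ} (hn : n ≤ k)
    {x : Fin (d + 1) → ℤ} {J : ℕ} (hJn : J ≤ n) (hxJ : blockMap (L ^ J) x ∈ cubeLamS L a M ρ k n J)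
    {j : ℕ} (hj : j ≤ n) (hxj : x ∈ cubeFam false L a M ρ k j) : j ≤ J := by
  by_contra hc
  push Not at hc
  rcases Nat.lt_or_ge J n with hJlt | hJge
  · have hxj' : x ∈ cube L a M ρ k j := by rw [← cubeFam_false_of_le L a M ρ (hj.trans hn)]; exact hxj
    exact not_mem_cube_of_tower_lt hL a M hρ hn hJlt hc (hj.trans hn) hxJ hxj'
  · omega

/-- Even powers of the level weights are monotone in the level: `wt(j)^{2m} ≤ wt(J)^{2m}` for `j ≤ J`, `L ≥ 1` (any real `η`).
[cite: Balaban1985RegularSpaces, (1.32) p.81] -/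
theorem wt_pow_even_mono {L : ℕ} (hL : 1 ≤ L) (η : ℝ) (m : ℕ) {j J : ℕ} (hjJ : j ≤ J) :
    wt L η j ^ (2 * m) ≤ wt L η J ^ (2 * m) := by
  have hL1 : (1 : ℝ) ≤ L := by exact_mod_cast hL
  have h2 : wt L η j ^ 2 ≤ wt L η J ^ 2 := by
    unfold wt
    rw [mul_pow, mul_pow]
    exact mul_le_mul_of_nonneg_right (pow_le_pow_left₀ (by positivity) (pow_le_pow_right₀ hL1 hjJ) 2) (sq_nonneg _)
  rw [pow_mul, pow_mul]
  exact pow_le_pow_left₀ (sq_nonneg _) h2 m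

/-! ## §2 (1.92) + the Δ-entry from (1.101) at exponents −2, −4 and the 𝒢-bound -/

open Classical in
/-- **(1.92) AND THE p. 93 Δ-ENTRY FROM (1.101) (EXPONENTS `−2 → 0` AND `−4 → −2`) AND THE 𝒢-BOUND, ON THE CUBE MEMBER — THE CONSUMER'S REAL-2 FAMILY REDUCED**
(B8 p. 91 (1.91)–(1.92) «H′ = G′²Q′*(Q′G′²Q′*)⁻¹ … |H′X| ≦ B′₀|X|», p. 92 «from Theorems 3.1, 3.2 of [4]»).  Data: the explicit matrices `T = (K(x,z))`, `Q` of
`B8Prop6CubeMemberFlatScalar.prop6_cubeMember_flat_of_real` at truncation `n` (any `L ≥ 1`, any nonnegative weights with normalised size `w_jη²L^{2j}L^{−(d+1)j} ≤ a_max`).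
Hypotheses: `hR1` = REAL-1 verbatim ((1.101) `|G′λ|₍₀₎, |∇G′λ|₍₋₁₎ ≦ B_G|λ|₍₋₂₎`); `hR1'` = (1.101) at print's exponent `γ = −4` ([4] (3.47) `|G′λ|₍₋₂₎ ≦ B_G′|λ|₍₋₄₎`,
function member); `hG` = the 𝒢-BOUND for `𝒢 = (QT⁻²Qᵀ)⁻¹` ([4] Theorem 3.2 (3.48), row-summed, in the consumer's normalisation: `wt(j)⁴·L^{−(d+1)j}·|(𝒢X)_p| ≤ C_𝒢·sup|X|` at a
level-`j` tower `p`).  Conclusion: the consumer's REAL-2 block verbatim — function member and gradient member with `B₀′_H = B_G·(B_G′·C_𝒢)`, Δ-entry with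
`B₂′ = B_G′·C_𝒢 + a_max`.  MECHANISM: `μ = 𝒢X`; `u = Qᵀμ` has ONE term per site (towers are disjoint, n05-e `towers_disjoint_cube`) and is `(−4)`-bounded by `hG`
and `j ≤ J` (`le_towerLevel`); `Y = T⁻¹u` is `(−2)`-bounded (`hR1'`); `λ = H′X = T⁻¹Y` gets the function and gradient members from `hR1`; the Δ-entry is the row
formula `η⁻²(−Δλ)(x) = (Tλ)(x) − w_J L^{−2(d+1)J}Σ_{block}λ = Y(x) − w_J L^{−(d+1)J}(Qλ)_{p(x)}` with `Qλ = QH′X = X` (`QH′ = 1`, n05-e `isUnit_towerGram`).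
[cite: Balaban1985RegularSpaces, (1.91)–(1.92) p.91, p.93, (1.101) p.93; Balaban1985BackgroundPropagators, Theorem 3.1 (3.47) p.398, Theorem 3.2 (3.48) p.398, (3.25) p.394] -/
theorem real2_of_real1_gbound {L : ℕ} (hL : 1 ≤ L) (a : Fin (d + 1) → ℤ) (M : ℕ) {ρ : ℕ} (hρ : L ≤ ρ) {k n : ℕ} (hn : n ≤ k)
    {η : ℝ} (hη : η ≠ 0) (w : ℕ → ℝ) (hw0 : ∀ j, 0 ≤ w j) {amax : ℝ} (hamax0 : 0 ≤ amax)
    (hamax : ∀ j, j ≤ n → w j * η ^ 2 * ((L : ℝ) ^ j) ^ 2 * ((((L : ℝ) ^ (d + 1)) ^ j))⁻¹ ≤ amax)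
    (S : Finset (Fin (d + 1) → ℤ)) (hS : ∀ x, x ∈ S ↔ x ∈ cubeFam false L a M ρ k 0)
    (B : Finset (ℕ × (Fin (d + 1) → ℤ))) (hB : ∀ p, p ∈ B ↔ p.1 ≤ n ∧ p.2 ∈ cubeLamS L a M ρ k n p.1)
    (K : (Fin (d + 1) → ℤ) → (Fin (d + 1) → ℤ) → ℝ)
    (hK : ∀ x z, K x z = ((η ^ 2)⁻¹ * ∑ μ : Fin (d + 1), ((2 : ℝ) * (if z = x then (1 : ℝ) else 0) - (if z = x + e μ then (1 : ℝ) else 0)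
        - (if z = x - e μ then (1 : ℝ) else 0))) +
        (∑ j ∈ Finset.range (n + 1), (if blockMap (L ^ j) x ∈ cubeLamS L a M ρ k n j ∧ blockMap (L ^ j) z = blockMap (L ^ j) x then
          w j * ((((L : ℝ) ^ (d + 1))⁻¹) ^ j) ^ 2 else 0)))
    (T : Matrix ↥S ↥S ℝ) (hT : T = Matrix.of (fun x z : ↥S => K x.1 z.1))
    (Q : Matrix ↥B ↥S ℝ) (hQ : Q = Matrix.of (fun (p : ↥B) (z : ↥S) =>
      if blockMap (L ^ p.1.1) z.1 = p.1.2 then (((L : ℝ) ^ (d + 1))⁻¹) ^ p.1.1 else 0))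
    {BG BG' CG : ℝ} (hBG' : 0 ≤ BG') (hCG : 0 ≤ CG)
    (hR1 : ∀ (ρ' : ↥S → ℝ) (r : ℝ), 0 ≤ r →
      (∀ j, j ≤ n → ∀ z : ↥S, z.1 ∈ cubeFam false L a M ρ k j → wt L η j ^ 2 * |ρ' z| ≤ r) →
      ∀ φ : (Fin (d + 1) → ℤ) → ℝ, (∀ x, x ∉ cubeFam false L a M ρ k 0 → φ x = 0) → (∀ v : ↥S, φ v.1 = ∑ z : ↥S, T⁻¹ v z * ρ' z) →
      (∀ x, |φ x| ≤ BG * r) ∧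
      ∀ j, j ≤ n → ∀ p ∈ {b : (Fin (d + 1) → ℤ) × Fin (d + 1) | SideTouches (cubeFam false L a M ρ k j) b.1 b.2},
        wt L η j * |η⁻¹ * (φ (p.1 + e p.2) - φ p.1)| ≤ BG * r)
    (hR1' : ∀ (u : ↥S → ℝ) (r : ℝ), 0 ≤ r →
      (∀ j, j ≤ n → ∀ z : ↥S, z.1 ∈ cubeFam false L a M ρ k j → wt L η j ^ 4 * |u z| ≤ r) →
      ∀ j, j ≤ n → ∀ v : ↥S, v.1 ∈ cubeFam false L a M ρ k j → wt L η j ^ 2 * |∑ z : ↥S, T⁻¹ v z * u z| ≤ BG' * r)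
    (hG : ∀ (X : ↥B → ℝ) (s : ℝ), 0 ≤ s → (∀ p', |X p'| ≤ s) → ∀ p : ↥B,
      wt L η p.1.1 ^ 4 * ((((L : ℝ) ^ (d + 1)) ^ p.1.1))⁻¹ * |∑ p' : ↥B, (Q * T⁻¹ * T⁻¹ * Qᵀ)⁻¹ p p' * X p'| ≤ CG * s)
    (X : ↥B → ℝ) (s : ℝ) (hs : 0 ≤ s) (hXs : ∀ p', |X p'| ≤ s)
    (φ : (Fin (d + 1) → ℤ) → ℝ) (hφ0 : ∀ x, x ∉ cubeFam false L a M ρ k 0 → φ x = 0)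
    (hφS : ∀ v : ↥S, φ v.1 = ∑ p' : ↥B, (T⁻¹ * (T⁻¹ * Qᵀ) * (Q * T⁻¹ * T⁻¹ * Qᵀ)⁻¹) v p' * X p') :
    (∀ x, |φ x| ≤ BG * (BG' * CG) * s) ∧
    (∀ j, j ≤ n → ∀ p ∈ {b : (Fin (d + 1) → ℤ) × Fin (d + 1) | SideTouches (cubeFam false L a M ρ k j) b.1 b.2},
      wt L η j * |η⁻¹ * (φ (p.1 + e p.2) - φ p.1)| ≤ BG * (BG' * CG) * s) ∧
    (∀ j, j ≤ n → ∀ x ∈ cubeFam false L a M ρ k j,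
      wt L η j ^ 2 * |∑ μ : Fin (d + 1), (η ^ 2)⁻¹ * (2 * φ x - φ (x + e μ) - φ (x - e μ))| ≤ (BG' * CG + amax) * s) := by
  have hd : 0 < d + 1 := Nat.succ_pos d
  have hL0 : (0 : ℝ) < L := by exact_mod_cast hL
  have hL1 : (1 : ℝ) ≤ L := by exact_mod_cast hL
  -- the units `T` and `QT⁻²Qᵀ`
  have hTunit : IsUnit T := by rw [hT]; exact isUnit_flatMatrix hd hη L n (cubeLamS L a M ρ k n) w hw0 K hK S
  have hTT : T * T⁻¹ = 1 := Matrix.mul_nonsing_inv T ((Matrix.isUnit_iff_isUnit_det T).mp hTunit)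
  have hTap : ∀ i j : ↥S, T i j = K i.1 j.1 := fun i j => by rw [hT]; rfl
  have hmeet : ∀ p ∈ B, ∃ z ∈ S, blockMap (L ^ p.1) z = p.2 := by
    intro p hp
    obtain ⟨hp1, hp2⟩ := (hB p).mp hp
    obtain ⟨z, hz, hzb⟩ := tower_meets_cube hL a M hρ hn p.1 hp1 p.2 hp2
    exact ⟨z, (hS z).mpr hz, hzb⟩
  have hdisjB : ∀ p ∈ B, ∀ p' ∈ B, ∀ z ∈ S, blockMap (L ^ p.1) z = p.2 → blockMap (L ^ p'.1) z = p'.2 → p = p' := by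
    intro p hp p' hp' z hz h1 h2
    obtain ⟨hp1, hp2⟩ := (hB p).mp hp
    obtain ⟨hp1', hp2'⟩ := (hB p').mp hp'
    obtain ⟨hjj, hyy⟩ := towers_disjoint_cube hL a M hρ hn p.1 hp1 p'.1 hp1' p.2 hp2 p'.2 hp2' z ((hS z).mp hz) h1 h2
    exact Prod.ext hjj hyy
  have hMunit : IsUnit (Q * T⁻¹ * T⁻¹ * Qᵀ) := by
    rw [hQ, hT]; exact isUnit_towerGram hd hη hL n (cubeLamS L a M ρ k n) w hw0 K hK S B hmeet hdisjB
  have hMM : (Q * T⁻¹ * T⁻¹ * Qᵀ) * (Q * T⁻¹ * T⁻¹ * Qᵀ)⁻¹ = 1 :=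
    Matrix.mul_nonsing_inv _ ((Matrix.isUnit_iff_isUnit_det _).mp hMunit)
  -- the letters `μ = 𝒢X`, `u = Qᵀμ`, `Y = T⁻¹u`
  set μ : ↥B → ℝ := (Q * T⁻¹ * T⁻¹ * Qᵀ)⁻¹ *ᵥ X with hμ
  have hμb : ∀ p : ↥B, wt L η p.1.1 ^ 4 * ((((L : ℝ) ^ (d + 1)) ^ p.1.1))⁻¹ * |μ p| ≤ CG * s := fun p => hG X s hs hXs p
  set u : ↥S → ℝ := Qᵀ *ᵥ μ with hu
  -- `u` has one term per site: the tower through the site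
  have hu_eq : ∀ z : ↥S, ∀ p : ↥B, blockMap (L ^ p.1.1) z.1 = p.1.2 → u z = (((L : ℝ) ^ (d + 1))⁻¹) ^ p.1.1 * μ p := by
    intro z p hzp
    rw [hu, Matrix.mulVec, dotProduct, Finset.sum_eq_single p]
    · rw [Matrix.transpose_apply, hQ, Matrix.of_apply, if_pos hzp]
    · intro p' _ hp'
      rw [Matrix.transpose_apply, hQ, Matrix.of_apply, if_neg, zero_mul]
      intro hc
      exact hp' (Subtype.ext (hdisjB p'.1 p'.2 p.1 p.2 z.1 z.2 hc hzp))
    · intro h; exact absurd (Finset.mem_univ _) h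
  -- `u` is `(−4)`-bounded by `C_𝒢 s`
  have hub : ∀ j, j ≤ n → ∀ z : ↥S, z.1 ∈ cubeFam false L a M ρ k j → wt L η j ^ 4 * |u z| ≤ CG * s := by
    intro j hj z hzj
    have hz0 : z.1 ∈ cubeFam false L a M ρ k 0 := (hS z.1).mp z.2
    obtain ⟨J, hJn, hzJ⟩ := cover_cubeMember hL a M hρ hn z.1 hz0
    have hjJ : j ≤ J := le_towerLevel hL a M hρ hn hJn hzJ hj hzj
    have hpB : (J, blockMap (L ^ J) z.1) ∈ B := (hB _).mpr ⟨hJn, hzJ⟩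
    rw [hu_eq z ⟨_, hpB⟩ rfl, abs_mul, abs_of_nonneg (by positivity : (0 : ℝ) ≤ (((L : ℝ) ^ (d + 1))⁻¹) ^ J), ← mul_assoc]
    have hwtle : wt L η j ^ 4 ≤ wt L η J ^ 4 := wt_pow_even_mono hL η 2 hjJ
    have hμp := hμb ⟨_, hpB⟩
    rw [← inv_pow] at hμp
    calc wt L η j ^ 4 * (((L : ℝ) ^ (d + 1))⁻¹) ^ J * |μ ⟨_, hpB⟩|
        ≤ wt L η J ^ 4 * (((L : ℝ) ^ (d + 1))⁻¹) ^ J * |μ ⟨_, hpB⟩| :=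
          mul_le_mul_of_nonneg_right (mul_le_mul_of_nonneg_right hwtle (by positivity)) (abs_nonneg _)
      _ ≤ CG * s := hμp
  set Y : ↥S → ℝ := T⁻¹ *ᵥ u with hY
  -- `Y = T⁻¹u` is `(−2)`-bounded by `B_G′ C_𝒢 s`
  have hYb : ∀ j, j ≤ n → ∀ v : ↥S, v.1 ∈ cubeFam false L a M ρ k j → wt L η j ^ 2 * |Y v| ≤ BG' * (CG * s) :=
    fun j hj v hv => hR1' u (CG * s) (by positivity) hub j hj v hv
  -- `λ = H′X = T⁻¹Y`
  have hlam : (T⁻¹ * (T⁻¹ * Qᵀ) * (Q * T⁻¹ * T⁻¹ * Qᵀ)⁻¹) *ᵥ X = T⁻¹ *ᵥ Y := by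
    rw [hY, hu, hμ, Matrix.mulVec_mulVec, Matrix.mulVec_mulVec, Matrix.mulVec_mulVec]
    simp only [Matrix.mul_assoc]
  have hφS' : ∀ v : ↥S, φ v.1 = ∑ z : ↥S, T⁻¹ v z * Y z := by
    intro v
    rw [hφS v]
    change ((T⁻¹ * (T⁻¹ * Qᵀ) * (Q * T⁻¹ * T⁻¹ * Qᵀ)⁻¹) *ᵥ X) v = (T⁻¹ *ᵥ Y) v
    rw [hlam]
  have hφ0' : ∀ x, x ∉ S → φ x = 0 := fun x hx => hφ0 x (fun h => hx ((hS x).mpr h))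
  -- the function and gradient members from REAL-1 at the source `Y`
  obtain ⟨hM1, hM2⟩ := hR1 Y (BG' * (CG * s)) (by positivity) hYb φ hφ0 hφS'
  have e1 : BG * (BG' * (CG * s)) = BG * (BG' * CG) * s := by ring
  refine ⟨fun x => by rw [← e1]; exact hM1 x, fun j hj p hp => by rw [← e1]; exact hM2 j hj p hp, ?_⟩
  -- the Δ-entry
  intro j hj x hxj
  have hx0 : x ∈ cubeFam false L a M ρ k 0 := cubeFam_subset_zero hL a M hρ k j hxj
  have hxS : x ∈ S := (hS x).mpr hx0
  -- `Qλ = X` (`QH′ = 1`) and `Tλ = Y` (`TT⁻¹ = 1`)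
  have hQlam : Q *ᵥ (T⁻¹ *ᵥ Y) = X := by
    rw [← hlam, Matrix.mulVec_mulVec]
    have : Q * (T⁻¹ * (T⁻¹ * Qᵀ) * (Q * T⁻¹ * T⁻¹ * Qᵀ)⁻¹) = 1 := by
      rw [show Q * (T⁻¹ * (T⁻¹ * Qᵀ) * (Q * T⁻¹ * T⁻¹ * Qᵀ)⁻¹) = (Q * T⁻¹ * T⁻¹ * Qᵀ) * (Q * T⁻¹ * T⁻¹ * Qᵀ)⁻¹ by
        simp only [← Matrix.mul_assoc], hMM]
    rw [this, Matrix.one_mulVec]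
  have hTlam : T *ᵥ (T⁻¹ *ᵥ Y) = Y := by rw [Matrix.mulVec_mulVec, hTT, Matrix.one_mulVec]
  -- the row of `T` at `x` against `λ` is the row of `K` against `φ`
  have hrow : (T *ᵥ (T⁻¹ *ᵥ Y)) ⟨x, hxS⟩ = ∑ z ∈ S, K x z * φ z := by
    rw [Matrix.mulVec, dotProduct, ← Finset.sum_coe_sort S]
    refine Finset.sum_congr rfl fun z _ => ?_
    rw [hTap, hφS' z]
    rfl
  -- the row formula at `x` (F2 `K_row_sum` on `S` enlarged by the lattice neighbours of `x`; `φ = 0` off `S`)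
  have hKrow : ∑ z ∈ S, K x z * φ z
      = (η ^ 2)⁻¹ * ∑ μ : Fin (d + 1), (2 * φ x - φ (x + e μ) - φ (x - e μ))
        + ∑ j' ∈ Finset.range (n + 1), (if blockMap (L ^ j') x ∈ cubeLamS L a M ρ k n j' then
            w j' * ((((L : ℝ) ^ (d + 1))⁻¹) ^ j') ^ 2 * ∑ z ∈ S.filter (fun z => blockMap (L ^ j') z = blockMap (L ^ j') x), φ z else 0) := by
    set S' : Finset (Fin (d + 1) → ℤ) := S ∪ (Finset.univ.image (fun μ : Fin (d + 1) => x + e μ)) ∪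
      (Finset.univ.image (fun μ : Fin (d + 1) => x - e μ)) with hS'
    have hsub : S ⊆ S' := fun z hz => by rw [hS']; exact Finset.mem_union_left _ (Finset.mem_union_left _ hz)
    have hxS' : x ∈ S' := hsub hxS
    have hxe : ∀ μ : Fin (d + 1), x + e μ ∈ S' ∧ x - e μ ∈ S' := fun μ =>
      ⟨by rw [hS']; exact Finset.mem_union_left _ (Finset.mem_union_right _ (Finset.mem_image.mpr ⟨μ, Finset.mem_univ _, rfl⟩)),
       by rw [hS']; exact Finset.mem_union_right _ (Finset.mem_image.mpr ⟨μ, Finset.mem_univ _, rfl⟩)⟩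
    have hvan : ∀ z ∈ S', z ∉ S → φ z = 0 := fun z _ hz => hφ0' z hz
    have h := K_row_sum L n (cubeLamS L a M ρ k n) w K hK S' hxS' hxe φ
    rw [← Finset.sum_subset hsub (fun z hz' hz => by rw [hvan z hz' hz, mul_zero])] at h
    rw [h]
    congr 1
    refine Finset.sum_congr rfl fun j' _ => ?_
    split_ifs with hc
    · rw [← Finset.sum_subset (Finset.filter_subset_filter _ hsub)
        (fun z hz' hz => hvan z (Finset.mem_of_mem_filter z hz') (fun hzS => hz (Finset.mem_filter.mpr ⟨hzS, (Finset.mem_filter.mp hz').2⟩)))]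
    · rfl
  -- the tower level `J` of `x`, `j ≤ J`, collapse of the level sum
  obtain ⟨J, hJn, hxJ⟩ := cover_cubeMember hL a M hρ hn x hx0
  have hjJ : j ≤ J := le_towerLevel hL a M hρ hn hJn hxJ hj hxj
  have hcollapse : ∑ j' ∈ Finset.range (n + 1), (if blockMap (L ^ j') x ∈ cubeLamS L a M ρ k n j' then
        w j' * ((((L : ℝ) ^ (d + 1))⁻¹) ^ j') ^ 2 * ∑ z ∈ S.filter (fun z => blockMap (L ^ j') z = blockMap (L ^ j') x), φ z else 0)
      = w J * ((((L : ℝ) ^ (d + 1))⁻¹) ^ J) ^ 2 * ∑ z ∈ S.filter (fun z => blockMap (L ^ J) z = blockMap (L ^ J) x), φ z := by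
    have h : ∀ j' ∈ Finset.range (n + 1), (if blockMap (L ^ j') x ∈ cubeLamS L a M ρ k n j' then
        w j' * ((((L : ℝ) ^ (d + 1))⁻¹) ^ j') ^ 2 * ∑ z ∈ S.filter (fun z => blockMap (L ^ j') z = blockMap (L ^ j') x), φ z else 0)
        = if J = j' then w J * ((((L : ℝ) ^ (d + 1))⁻¹) ^ J) ^ 2 * ∑ z ∈ S.filter (fun z => blockMap (L ^ J) z = blockMap (L ^ J) x), φ z else 0 := by
      intro j' hj'
      have hj'n : j' ≤ n := Nat.lt_succ_iff.mp (Finset.mem_range.mp hj')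
      by_cases hc : blockMap (L ^ j') x ∈ cubeLamS L a M ρ k n j'
      · have hjj : j' = J := (towers_disjoint_cube hL a M hρ hn j' hj'n J hJn _ hc _ hxJ x hx0 rfl rfl).1
        subst hjj; rw [if_pos hc, if_pos rfl]
      · have hne : J ≠ j' := fun h => by subst h; exact hc hxJ
        rw [if_neg hc, if_neg hne]
    rw [Finset.sum_congr rfl h, Finset.sum_ite_eq, if_pos (Finset.mem_range.mpr (Nat.lt_succ_of_le hJn))]
  -- the block sum is `L^{(d+1)J}·X_{p(x)}`
  have hpB : (J, blockMap (L ^ J) x) ∈ B := (hB _).mpr ⟨hJn, hxJ⟩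
  have hblock : ∑ z ∈ S.filter (fun z => blockMap (L ^ J) z = blockMap (L ^ J) x), φ z
      = ((L : ℝ) ^ (d + 1)) ^ J * X ⟨(J, blockMap (L ^ J) x), hpB⟩ := by
    have hQl : (Q *ᵥ (T⁻¹ *ᵥ Y)) ⟨(J, blockMap (L ^ J) x), hpB⟩
        = (((L : ℝ) ^ (d + 1))⁻¹) ^ J * ∑ z ∈ S.filter (fun z => blockMap (L ^ J) z = blockMap (L ^ J) x), φ z := by
      rw [Matrix.mulVec, dotProduct, Finset.sum_filter, Finset.mul_sum, ← Finset.sum_coe_sort S]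
      refine Finset.sum_congr rfl fun z _ => ?_
      rw [hQ, Matrix.of_apply, hφS' z]
      change (if blockMap (L ^ J) z.1 = blockMap (L ^ J) x then (((L : ℝ) ^ (d + 1))⁻¹) ^ J else 0) * (T⁻¹ *ᵥ Y) z
        = (((L : ℝ) ^ (d + 1))⁻¹) ^ J * (if blockMap (L ^ J) z.1 = blockMap (L ^ J) x then (T⁻¹ *ᵥ Y) z else 0)
      split_ifs <;> ring
    rw [hQlam] at hQl
    rw [hQl, inv_pow, ← mul_assoc, mul_inv_cancel₀ (by positivity), one_mul]
  -- the weight factor `(Lʲη)²·w_J·L^{−(d+1)J} ≤ a_max` (`j ≤ J`)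
  have hwt : wt L η j ^ 2 * (w J * ((((L : ℝ) ^ (d + 1))⁻¹) ^ J) ^ 2 * ((L : ℝ) ^ (d + 1)) ^ J) ≤ amax := by
    have hJ := hamax J hJn
    have hid : wt L η j ^ 2 * (w J * ((((L : ℝ) ^ (d + 1))⁻¹) ^ J) ^ 2 * ((L : ℝ) ^ (d + 1)) ^ J)
        = (w J * η ^ 2 * ((L : ℝ) ^ J) ^ 2 * ((((L : ℝ) ^ (d + 1)) ^ J))⁻¹) * (((L : ℝ) ^ j) ^ 2 / ((L : ℝ) ^ J) ^ 2) := by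
      unfold wt; rw [inv_pow]; field_simp
    rw [hid]
    have hratio : ((L : ℝ) ^ j) ^ 2 / ((L : ℝ) ^ J) ^ 2 ≤ 1 := by
      rw [div_le_one (by positivity)]
      exact pow_le_pow_left₀ (by positivity) (pow_le_pow_right₀ hL1 hjJ) 2
    have hnn : 0 ≤ w J * η ^ 2 * ((L : ℝ) ^ J) ^ 2 * ((((L : ℝ) ^ (d + 1)) ^ J))⁻¹ := by
      have := hw0 J; positivity
    calc (w J * η ^ 2 * ((L : ℝ) ^ J) ^ 2 * ((((L : ℝ) ^ (d + 1)) ^ J))⁻¹) * (((L : ℝ) ^ j) ^ 2 / ((L : ℝ) ^ J) ^ 2)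
        ≤ amax * 1 := mul_le_mul hJ hratio (by positivity) hamax0
      _ = amax := mul_one _
  -- assemble: `η⁻²(−Δφ)(x) = Y(x) − w_J L^{−2(d+1)J}·L^{(d+1)J}·X_{p(x)}`
  have hYx : wt L η j ^ 2 * |Y ⟨x, hxS⟩| ≤ BG' * (CG * s) := hYb j hj ⟨x, hxS⟩ hxj
  have hLapEq : (η ^ 2)⁻¹ * ∑ μ' : Fin (d + 1), (2 * φ x - φ (x + e μ') - φ (x - e μ'))
      = Y ⟨x, hxS⟩ - w J * ((((L : ℝ) ^ (d + 1))⁻¹) ^ J) ^ 2 * (((L : ℝ) ^ (d + 1)) ^ J * X ⟨(J, blockMap (L ^ J) x), hpB⟩) := by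
    have h := hrow
    rw [hTlam, hKrow, hcollapse, hblock] at h
    linarith
  have hwt0 : 0 ≤ wt L η j ^ 2 := sq_nonneg _
  rw [← Finset.mul_sum, hLapEq]
  have hblk : wt L η j ^ 2 * |w J * ((((L : ℝ) ^ (d + 1))⁻¹) ^ J) ^ 2 * (((L : ℝ) ^ (d + 1)) ^ J * X ⟨(J, blockMap (L ^ J) x), hpB⟩)|
      ≤ amax * s := by
    rw [show w J * ((((L : ℝ) ^ (d + 1))⁻¹) ^ J) ^ 2 * (((L : ℝ) ^ (d + 1)) ^ J * X ⟨(J, blockMap (L ^ J) x), hpB⟩)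
        = (w J * ((((L : ℝ) ^ (d + 1))⁻¹) ^ J) ^ 2 * ((L : ℝ) ^ (d + 1)) ^ J) * X ⟨(J, blockMap (L ^ J) x), hpB⟩ by ring,
      abs_mul, abs_of_nonneg (by have := hw0 J; positivity), ← mul_assoc]
    exact mul_le_mul hwt (hXs _) (abs_nonneg _) hamax0
  calc wt L η j ^ 2 * |Y ⟨x, hxS⟩ - w J * ((((L : ℝ) ^ (d + 1))⁻¹) ^ J) ^ 2 * (((L : ℝ) ^ (d + 1)) ^ J * X ⟨(J, blockMap (L ^ J) x), hpB⟩)|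
      ≤ wt L η j ^ 2 * (|Y ⟨x, hxS⟩| + |w J * ((((L : ℝ) ^ (d + 1))⁻¹) ^ J) ^ 2 * (((L : ℝ) ^ (d + 1)) ^ J * X ⟨(J, blockMap (L ^ J) x), hpB⟩)|) :=
        mul_le_mul_of_nonneg_left (abs_sub _ _) hwt0
    _ ≤ BG' * (CG * s) + amax * s := by rw [mul_add]; exact add_le_add hYx hblk
    _ = (BG' * CG + amax) * s := by ring

end Literature.MathematicalPhysics.QuantumFieldTheory.Balaban1983to89.B8Eq192CubeMemberOfReal1G
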